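import Literature.AlgebraicGeometry.Resolution.KollarSurfaceMarkedOrderReductionTame
import Literature.AlgebraicGeometry.Resolution.EffectiveResolutionMarked
import HarnessLib

/-!
# Kollár's Theorem 3.69 and principalization (Thm. 3.21) on smooth integral surfaces over perfect fields of characteristic `p > max-ord` (Kollár 2007, Thms. 3.69, 3.21 / 3.72)

Topic: `Literature/AlgebraicGeometry/Resolution`. J. Kollár, *Lectures on Resolution of
Singularities* (2007): Thm. 3.69 (order reduction for marked ideals, p. 150) and its reading as
principalization, 3.72 / Thm. 3.21 (pp. 151–152: "`Π^* I = I_r · 𝒪_{X_r}(F)` for some effective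
divisor `F` … Here `I_r = 𝒪_{X_r}` since `max-ord I_r < 1`"). The previous file
(`KollarSurfaceMarkedOrderReductionTame.lean`) proves Thm. 3.69 for Kollár's surface TRIPLES
(Notation 3.64) in the tame regime. This file unpacks the triple for the working reader: an
INTEGRAL scheme `X`, smooth and quasi-compact over a perfect field `k` of characteristic `p`, of
dimension `2`, a non-zero ideal sheaf `I`, an ordered simple normal crossing boundary `E` without
repeated non-empty members, a marking `m ≥ 1`.

* **`Kollar2007.exists_isResolutionOf_marked_of_isIntegral_surface`** — if `max-ord I ≤ μ` and
  `p = 0 ∨ (μ < p ∧ m(m-1) < p)`, a blow-up sequence RESOLVES `(X, I, E, m)` (BGMW Def. 3.1.3);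
* `Kollar2007.exists_isResolutionOf_marked_of_isIntegral_surface_nil` — the case `E = ∅`;
* **`Kollar2007.exists_principalization_of_isIntegral_surface`** — PRINCIPALIZATION in the tame
  regime (`m = 1`, `E = ∅`, `p = 0 ∨ max-ord I < p`): a smooth blow-up sequence (regular centres
  inside the successive zero loci `V(I_i)`, simple normal crossings with the exceptional
  divisors) whose final controlled transform `(Π^*I : 𝓘_exc)` is the unit ideal — Kollár's
  Thm. 3.21 for surfaces in characteristic `p > max-ord I`;
* `Kollar2007.hasResolution_of_isClosedImmersion_surface` — resolution of singularities of the
  integral proper closed subschemes `Y` (curves) of such a surface with `p > max-ord 𝓘_Y`, through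
  the embedded-resolution reading of BGMW §3.3 (`IsMarkedResolution.hasResolution`).

## Sources

* J. Kollár, *Lectures on Resolution of Singularities*, Ann. of Math. Stud. 166 (2007):
  Thm. 3.69 (p. 150), Thm. 3.21 and 3.72 (pp. 122, 151–152), Notation 3.64 (p. 148), 3.111.
  [Kollar2007]
* E. Bierstone, D. Grigoriev, P. Milman, J. Włodarczyk, arXiv:1206.3090: Def. 3.1.3, §3.3,
  Thm. 8.0.4. [BierstoneGrigorievMilmanWlodarczyk2011]
-/

noncomputable section

open CategoryTheory CategoryTheory.Limits AlgebraicGeometry TopologicalSpace IsLocalRing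

namespace Literature.AlgebraicGeometry.Resolution

universe u

namespace Kollar2007

variable (k : Type u) [Field k] (X : Scheme.{u}) [X.Over (Spec (.of k))]

/-- **Kollár's Thm. 3.69 on a smooth integral surface over a perfect field, tame regime.** Let
`X` be integral, smooth and quasi-compact over a perfect field `k` of characteristic `p`
(`p = 0` allowed), of dimension `2`; `I ≠ 0` an ideal sheaf with `max-ord I ≤ μ`; `E` an
ordered simple normal crossing boundary without repeated non-empty members; `m ≥ 1`; and
`p = 0 ∨ (μ < p ∧ m·(m-1) < p)`. Then a blow-up sequence RESOLVES the marked ideal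
`(X, I, E, m)` (`X` with `I`, `E` is a triple of Notation 3.64 of dimension `2`, GW Thm. 5.22;
then `Triple.exists_isResolutionOf_marked_two'`). [cite: Kollar2007, Thm. 3.69 (p. 150), Notation 3.64, 3.111]
[cite: BierstoneGrigorievMilmanWlodarczyk2011, Def. 3.1.3, Thm. 8.0.4] -/
theorem exists_isResolutionOf_marked_of_isIntegral_surface (p : ℕ) [CharP k p] [PerfectField k]
    [Smooth (X ↘ Spec (.of k))] [QuasiCompact (X ↘ Spec (.of k))] [IsIntegral X]
    (hX2 : topologicalKrullDim X = 2) (I : X.IdealSheafData) (hI : I ≠ ⊥)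
    {E : List X.IdealSheafData} (hE : HasSNC E) (hEpw : E.Pairwise fun D D' => D = D' → D = ⊤)
    {m : ℕ} (hm : 1 ≤ m) {μ : ℕ} (hmax : ∀ x : X, idealOrder I x ≤ μ)
    (hp : p = 0 ∨ (μ < p ∧ m * (m - 1) < p)) :
    ∃ s : CentreSeq X, s.IsResolutionOf ⟨I, E, m⟩ := by
  haveI : IsLocallyNoetherian X := isLocallyNoetherian_of_locallyOfFiniteType_over k X
  have hXreg : Scheme.IsRegular X := Scheme.isRegular_of_smooth_over_field k X
  obtain ⟨n, hn⟩ := exists_equidim_of_isIntegral (X ↘ Spec (.of k))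
  have hn2 : n = 2 := by
    have huniv : (Set.univ : Set X) ∈ irreducibleComponents X := by
      rw [irreducibleComponents_eq_singleton]; exact Set.mem_singleton _
    have h1 := hn _ huniv
    rw [IsHomeomorph.topologicalKrullDim_eq _ (Homeomorph.Set.univ X).isHomeomorph, hX2] at h1
    exact_mod_cast h1.symm
  subst hn2
  let T : Triple k 2 :=
    { X := X, struct := X ↘ Spec (.of k), isRegular := hXreg, equidim := hn, ideal := I,
      stalkIdeal_ne_bot := stalkIdeal_ne_bot_of_ne_bot hI, boundary := E,
      hasSNC := hE, boundary_pairwise := hEpw }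
  exact T.exists_isResolutionOf_marked_two' p hm hmax hp

/-- The case of the empty boundary. [cite: Kollar2007, Thm. 3.69 (p. 150)] -/
theorem exists_isResolutionOf_marked_of_isIntegral_surface_nil (p : ℕ) [CharP k p] [PerfectField k]
    [Smooth (X ↘ Spec (.of k))] [QuasiCompact (X ↘ Spec (.of k))] [IsIntegral X]
    (hX2 : topologicalKrullDim X = 2) (I : X.IdealSheafData) (hI : I ≠ ⊥)
    {m : ℕ} (hm : 1 ≤ m) {μ : ℕ} (hmax : ∀ x : X, idealOrder I x ≤ μ)
    (hp : p = 0 ∨ (μ < p ∧ m * (m - 1) < p)) :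
    ∃ s : CentreSeq X, s.IsResolutionOf ⟨I, [], m⟩ := by
  haveI : IsLocallyNoetherian X := isLocallyNoetherian_of_locallyOfFiniteType_over k X
  exact exists_isResolutionOf_marked_of_isIntegral_surface k X p hX2 I hI
    (hasSNC_nil_of_isRegular (Scheme.isRegular_of_smooth_over_field k X)) List.Pairwise.nil hm hmax hp

/-- **Principalization on smooth integral surfaces in characteristic `p > max-ord I`** (Kollár
Thm. 3.21 via 3.72: order reduction for `(X, I, ∅, 1)` ends with `max-ord I_r < 1`, i.e. the
controlled transform `I_r = (Π^*I : 𝓘_exc)` is the structure sheaf). For `X` integral, smooth and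
quasi-compact over a perfect field `k` of characteristic `p`, of dimension `2`, and `I ≠ 0` with
`max-ord I ≤ μ`, `p = 0 ∨ μ < p`: there is a smooth blow-up sequence, with regular centres
inside the successive zero loci and simple normal crossings with the exceptional divisors,
whose final controlled transform of `I` (multiplicity one) is the unit ideal.
[cite: Kollar2007, Thm. 3.21 (p. 122), 3.72 (pp. 151–152), Thm. 3.69]
[cite: BierstoneGrigorievMilmanWlodarczyk2011, §3.3, Thm. 8.0.4] -/
theorem exists_principalization_of_isIntegral_surface (p : ℕ) [CharP k p] [PerfectField k]
    [Smooth (X ↘ Spec (.of k))] [QuasiCompact (X ↘ Spec (.of k))] [IsIntegral X]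
    (hX2 : topologicalKrullDim X = 2) (I : X.IdealSheafData) (hI : I ≠ ⊥) {μ : ℕ}
    (hmax : ∀ x : X, idealOrder I x ≤ μ) (hp : p = 0 ∨ μ < p) :
    ∃ s : CentreSeq X, s.IsAdmissibleFor ⟨I, [], 1⟩ ∧ (s.transformMarked ⟨I, [], 1⟩).ideal = ⊤ := by
  obtain ⟨s, hs⟩ := exists_isResolutionOf_marked_of_isIntegral_surface_nil k X p hX2 I hI le_rfl hmax
    (hp.imp id fun h => ⟨h, by simpa using Nat.pos_of_ne_zero (by rintro rfl; simp at h)⟩)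
  refine ⟨s, hs.1, ?_⟩
  have hsupp := hs.2
  rw [MarkedIdeal.support_of_mult_eq_one _ (CentreSeq.transformMarked_mult s _)] at hsupp
  rw [← Scheme.IdealSheafData.support_eq_bot_iff]
  ext x
  simp only [TopologicalSpace.Closeds.coe_bot, Set.mem_empty_iff_false, iff_false]
  intro hx
  have : x ∈ (((s.transformMarked ⟨I, [], 1⟩).ideal.support : Set s.top)) := hx
  rw [hsupp] at this
  exact this

/-- **Resolution of an integral closed subscheme of a smooth integral surface in characteristic
`p > max-ord`, by Kollár's algorithm** (BGMW §3.3 (1) ⇒ (4): a resolution of the marked ideal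
`(𝓘_Y, ∅, 1)` is an embedded resolution of `Y`, whose strict transform at the stage where it is
first blown up is regular; tree: `IsMarkedResolution.hasResolution`). For `X` integral, smooth and
quasi-compact over a perfect field `k` of characteristic `p`, of dimension `2`, and `Y ↪ X` an
integral proper closed subscheme (`𝓘_Y ≠ 0`; a curve or a point) with `max-ord 𝓘_Y ≤ μ`,
`p = 0 ∨ μ < p`: `Y` has a resolution of singularities (`Scheme.HasResolution`: a proper
birational morphism from a regular scheme). [cite: BierstoneGrigorievMilmanWlodarczyk2011, §3.3 (1)⇒(4), Thm. 8.0.4]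
[cite: Kollar2007, Thm. 3.69, Thm. 3.21] -/
theorem hasResolution_of_isClosedImmersion_surface (p : ℕ) [CharP k p] [PerfectField k]
    [Smooth (X ↘ Spec (.of k))] [QuasiCompact (X ↘ Spec (.of k))] [IsIntegral X]
    (hX2 : topologicalKrullDim X = 2) {Y : Scheme.{u}} [IsIntegral Y] (ι : Y ⟶ X)
    [IsClosedImmersion ι] (hY : ι.ker ≠ ⊥) {μ : ℕ} (hmax : ∀ x : X, idealOrder ι.ker x ≤ μ)
    (hp : p = 0 ∨ μ < p) : Scheme.HasResolution Y := by
  haveI : IsLocallyNoetherian X := isLocallyNoetherian_of_locallyOfFiniteType_over k X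
  obtain ⟨s, hs⟩ := exists_isResolutionOf_marked_of_isIntegral_surface_nil k X p hX2 ι.ker hY le_rfl
    hmax (hp.imp id fun h => ⟨h, by simpa using Nat.pos_of_ne_zero (by rintro rfl; simp at h)⟩)
  exact IsMarkedResolution.hasResolution ι [] hs.isMarkedResolution

end Kollar2007

end Literature.AlgebraicGeometry.Resolution

end
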